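import Mathlib.Data.Nat.Choose.Sum
import Mathlib.LinearAlgebra.Matrix.ToLinearEquiv
import Mathlib.LinearAlgebra.Matrix.NonsingularInverse
import Mathlib.LinearAlgebra.Matrix.DotProduct
import Summits.CriticalPhenomena.PercolationContinuityZ3.Theorems.PercNearOneGluingNoHeavyLowerTailAntiBandMiddleLevel

/-!
# `NoHeavyLowerTail` (crux stmt-CriticalPhenomena-4575), lane prim-ineq-gen-4 (gen 27): the diagonal GAP chain — `Q_UU ⪰ 0 ⇒ det M_U ≠ 0` at `|β| = 2k+2`

Support file (`--supports stmt-CriticalPhenomena-4575`; memos FINDING-SPECTRAL-GAP-g26 §0(2),(3), PROP 7 and FINDING-OFFDIAG-UNIVERSAL-g27 §7(d)(iii)).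
No definitions, no `sorry`, standard axioms.

Let `|β| = 2k+2`, `U` up-closed inside the ball of radius `k`, `V[y,x] = [x ⊆ y]` (`y` a `(k+1)`-set), `Z[z,x] = [x ⊆ z]`, `S = diag (−1)^{k−#z}`, `P = VᵀV`
(`P[z,z'] = C(2k+2 − #(z∪z'), k+1)`), and `q(z,z') = P[z,z'] − [z ⊆ z'] − [z' ⊆ z]` (g26's universal kernel restricted to `U`).  THEOREM
(`det_binomial_ne_zero_of_qform_nonneg`): if `Σ_{z,z'∈U} g(z) g(z') q(z,z') ≥ 0` for every `g : U → ℚ`, then `det [C(|β|−1−#(x∪x'),k)]_{x,x'∈U} ≠ 0`.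
Proof (elementary linear algebra): `M_U = VᵀV − ZᵀSZ` (gen 26, `AntiBandMiddleLevel`), `V S Z = V` and `Z W = 1` for the signed Möbius matrix `W` (two interval alternating
sums, `mul_sign_zeta_eq`, `zeta_mul_moebius_eq_one`); a null vector `c₀` of `M_U` gives `u = S Z c₀` with `P u = S u` and `Zᵀ u = S u`, whence
`Σ u u q = uᵀPu − 2uᵀSu = −‖Vu‖²`; the hypothesis forces `Vu = 0`, then `u = 0`, `c₀ = 0`.  With the type-free Gram identities (`AntiBandGramK2` for `k = 2`; k = 3, 4 to come)
this yields g26 THEOREM A — (AB_3)(6), (AB_4)(8), (AB_5)(10) — in the kernel.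
-/

namespace Summit.CriticalPhenomena.PercolationContinuityZ3.Theorems.AntiBandDiagGap

open Finset Matrix

variable {β : Type*} [DecidableEq β] [Fintype β]

omit [Fintype β] in
/-- Interval alternating sum, truncated at the top: for `x ∈ U` (up-closed in the ball of radius `k`), `#y = k+1`, `x ⊆ y`:
`Σ_{z ∈ U, x ⊆ z ⊆ y} (−1)^{k − #z} = 1`. [elementary] -/
theorem sum_interval_neg_one_pow (k : ℕ) (U : Finset (Finset β)) (hUk : ∀ z ∈ U, #z ≤ k)
    (hup : ∀ x ∈ U, ∀ z : Finset β, x ⊆ z → #z ≤ k → z ∈ U) (x y : Finset β) (hx : x ∈ U) (hxy : x ⊆ y) (hy : #y = k + 1) :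
    ∑ z ∈ U.filter (fun z => x ⊆ z ∧ z ⊆ y), (-1 : ℤ) ^ (k - #z) = 1 := by
  have hxk : #x ≤ k := hUk x hx
  -- rewrite the exponent
  have h1 : ∑ z ∈ U.filter (fun z => x ⊆ z ∧ z ⊆ y), (-1 : ℤ) ^ (k - #z)
      = ∑ z ∈ U.filter (fun z => x ⊆ z ∧ z ⊆ y), (-1 : ℤ) ^ k * (-1 : ℤ) ^ #z := by
    apply Finset.sum_congr rfl
    intro z hz
    rw [mem_filter] at hz
    exact AntiBandMiddleLevel.neg_one_pow_sub_eq_mul k #z (hUk z hz.1)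
  -- bijection with the proper subsets of `y \ x`
  have h2 : ∑ z ∈ U.filter (fun z => x ⊆ z ∧ z ⊆ y), (-1 : ℤ) ^ k * (-1 : ℤ) ^ #z
      = ∑ t ∈ (y \ x).powerset.erase (y \ x), (-1 : ℤ) ^ k * ((-1 : ℤ) ^ #x * (-1 : ℤ) ^ #t) := by
    apply Finset.sum_bij' (fun z _ => z \ x) (fun t _ => x ∪ t)
    · intro z hz
      rw [mem_filter] at hz
      rw [mem_erase, mem_powerset]
      refine ⟨?_, sdiff_subset_sdiff hz.2.2 (subset_refl _)⟩
      intro h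
      have hzy : z = y := by
        have : x ∪ (z \ x) = x ∪ (y \ x) := by rw [h]
        rw [union_sdiff_of_subset hz.2.1, union_sdiff_of_subset hxy] at this
        exact this
      have := hUk z hz.1
      rw [hzy] at this; omega
    · intro t ht
      rw [mem_erase, mem_powerset] at ht
      have htsub : x ∪ t ⊆ y := union_subset hxy (ht.2.trans sdiff_subset)
      have hne : x ∪ t ≠ y := by
        intro h
        apply ht.1
        have : (x ∪ t) \ x = y \ x := by rw [h]
        rw [union_sdiff_left] at this
        rw [← this]
        symm
        apply sdiff_eq_self_of_disjoint
        exact Finset.disjoint_left.mpr (fun a hat hax => (mem_sdiff.mp (ht.2 hat)).2 hax)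
      have hcard : #(x ∪ t) ≤ k := by
        have hlt : #(x ∪ t) < #y := card_lt_card (Finset.ssubset_iff_subset_ne.mpr ⟨htsub, hne⟩)
        omega
      rw [mem_filter]
      exact ⟨hup x hx (x ∪ t) subset_union_left hcard, subset_union_left, htsub⟩
    · intro z hz
      rw [mem_filter] at hz
      exact union_sdiff_of_subset hz.2.1
    · intro t ht
      rw [mem_erase, mem_powerset] at ht
      rw [union_sdiff_left]
      apply sdiff_eq_self_of_disjoint
      exact Finset.disjoint_left.mpr (fun a hat hax => (mem_sdiff.mp (ht.2 hat)).2 hax)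
    · intro z hz
      rw [mem_filter] at hz
      congr 1
      rw [← pow_add]
      congr 1
      have := card_sdiff_add_card_eq_card hz.2.1
      omega
  have hne : (y \ x).Nonempty := by
    rw [← card_pos, card_sdiff_of_subset hxy]; omega
  have hmem : y \ x ∈ (y \ x).powerset := mem_powerset.mpr (subset_refl _)
  have h3 : ∑ t ∈ (y \ x).powerset.erase (y \ x), (-1 : ℤ) ^ k * ((-1 : ℤ) ^ #x * (-1 : ℤ) ^ #t)
      = (-1 : ℤ) ^ k * (-1 : ℤ) ^ #x * (∑ t ∈ (y \ x).powerset, (-1 : ℤ) ^ #t - (-1 : ℤ) ^ #(y \ x)) := by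
    rw [← Finset.sum_erase_add _ _ hmem, add_sub_cancel_right, Finset.mul_sum]
    apply Finset.sum_congr rfl; intro t _; ring
  rw [h1, h2, h3, Finset.sum_powerset_neg_one_pow_card_of_nonempty hne, zero_sub, card_sdiff_of_subset hxy, hy]
  have e : k + 1 - #x = (k - #x) + 1 := by omega
  rw [e, pow_succ, AntiBandMiddleLevel.neg_one_pow_sub_eq_mul k #x hxk]
  have hsq : ∀ m : ℕ, (-1 : ℤ) ^ m * (-1 : ℤ) ^ m = 1 := by
    intro m; rw [← pow_add, ← two_mul, pow_mul, neg_one_sq, one_pow]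
  have : (-1 : ℤ) ^ k * (-1 : ℤ) ^ #x * -((-1 : ℤ) ^ k * (-1 : ℤ) ^ #x * (-1))
      = ((-1 : ℤ) ^ k * (-1 : ℤ) ^ k) * ((-1 : ℤ) ^ #x * (-1 : ℤ) ^ #x) := by ring
  rw [this, hsq, hsq, one_mul]

omit [Fintype β] in
/-- Full interval alternating sum: for `x ∈ U` (up-closed in the ball of radius `k`), `z ∈ U`, `x ⊆ z`:
`Σ_{w ∈ U, x ⊆ w ⊆ z} (−1)^{#w + #x} = [z = x]`. [elementary] -/
theorem sum_interval_neg_one_pow_full (k : ℕ) (U : Finset (Finset β)) (hUk : ∀ z ∈ U, #z ≤ k)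
    (hup : ∀ x ∈ U, ∀ z : Finset β, x ⊆ z → #z ≤ k → z ∈ U) (x z : Finset β) (hx : x ∈ U) (hz : z ∈ U) (hxz : x ⊆ z) :
    ∑ w ∈ U.filter (fun w => x ⊆ w ∧ w ⊆ z), (-1 : ℤ) ^ (#w + #x) = if z = x then 1 else 0 := by
  have hzk : #z ≤ k := hUk z hz
  have h2 : ∑ w ∈ U.filter (fun w => x ⊆ w ∧ w ⊆ z), (-1 : ℤ) ^ (#w + #x)
      = ∑ t ∈ (z \ x).powerset, ((-1 : ℤ) ^ #x) ^ 2 * (-1 : ℤ) ^ #t := by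
    apply Finset.sum_bij' (fun w _ => w \ x) (fun t _ => x ∪ t)
    · intro w hw
      rw [mem_filter] at hw
      rw [mem_powerset]
      exact sdiff_subset_sdiff hw.2.2 (subset_refl _)
    · intro t ht
      rw [mem_powerset] at ht
      have htsub : x ∪ t ⊆ z := union_subset hxz (ht.trans sdiff_subset)
      have hcard : #(x ∪ t) ≤ k := (card_le_card htsub).trans hzk
      rw [mem_filter]
      exact ⟨hup x hx (x ∪ t) subset_union_left hcard, subset_union_left, htsub⟩
    · intro w hw
      rw [mem_filter] at hw
      exact union_sdiff_of_subset hw.2.1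
    · intro t ht
      rw [mem_powerset] at ht
      rw [union_sdiff_left]
      apply sdiff_eq_self_of_disjoint
      exact Finset.disjoint_left.mpr (fun a hat hax => (mem_sdiff.mp (ht hat)).2 hax)
    · intro w hw
      rw [mem_filter] at hw
      rw [sq, ← pow_add, ← pow_add]
      congr 1
      have := card_sdiff_add_card_eq_card hw.2.1
      omega
  rw [h2, ← Finset.mul_sum, Finset.sum_powerset_neg_one_pow_card]
  have h5 : ((-1 : ℤ) ^ #x) ^ 2 = 1 := by rw [← pow_mul, mul_comm, pow_mul, neg_one_sq, one_pow]
  rw [h5, one_mul]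
  by_cases h : z = x
  · subst h; simp
  · rw [if_neg h, if_neg]
    intro h'
    apply h
    rw [sdiff_eq_empty_iff_subset] at h'
    exact Finset.Subset.antisymm h' hxz

/-- **The diagonal GAP chain.**  `|β| = 2k+2`, `U` up-closed inside the ball of radius `k`.  If the universal kernel restricted to `U`,
`q(z,z') = C(2k+2 − #(z∪z'), k+1) − [z ⊆ z'] − [z' ⊆ z]`, is positive semidefinite (`∀ g, Σ g g q ≥ 0`), then the binomial matrix of the determinant criterion is
nonsingular: `det [C(|β|−1−#(x∪x'), k)]_{x,x'∈U} ≠ 0`.  [gen 27; g26 PROP 1/3/7 at N = 1] -/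
theorem det_binomial_ne_zero_of_qform_nonneg (k : ℕ) (hβ : Fintype.card β = 2 * k + 2) (U : Finset (Finset β))
    (hUk : ∀ x ∈ U, #x ≤ k) (hup : ∀ x ∈ U, ∀ z : Finset β, x ⊆ z → #z ≤ k → z ∈ U)
    (hQ : ∀ g : ↥U → ℚ, 0 ≤ ∑ z : ↥U, ∑ z' : ↥U, g z * g z' *
        ((((2 * k + 2 - #((z : Finset β) ∪ z')).choose (k + 1) : ℕ) : ℚ)
          - (if (z : Finset β) ⊆ z' then 1 else 0) - (if (z' : Finset β) ⊆ z then 1 else 0))) :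
    (Matrix.of fun (x x' : ↥U) => ((Fintype.card β - 1 - #((x : Finset β) ∪ x')).choose k : ℤ)).det ≠ 0 := by
  classical
  set Y : Finset (Finset β) := (univ : Finset β).powersetCard (k + 1) with hYdef
  set V : Matrix ↥Y ↥U ℤ := Matrix.of fun (y : ↥Y) (x : ↥U) => if (x : Finset β) ⊆ y then (1 : ℤ) else 0 with hVdef
  set Z : Matrix ↥U ↥U ℤ := Matrix.of fun (z x : ↥U) => if (x : Finset β) ⊆ z then (1 : ℤ) else 0 with hZdef
  set S : Matrix ↥U ↥U ℤ := Matrix.diagonal fun (z : ↥U) => (-1 : ℤ) ^ (k - #(z : Finset β)) with hSdef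
  set W : Matrix ↥U ↥U ℤ := Matrix.of fun (w x : ↥U) => if (x : Finset β) ⊆ w then (-1 : ℤ) ^ (#(w : Finset β) + #(x : Finset β)) else 0 with hWdef
  have hcardM : (Matrix.of fun (x x' : ↥U) => ((Fintype.card β - 1 - #((x : Finset β) ∪ x')).choose k : ℤ))
      = Matrix.of fun (x x' : ↥U) => ((2 * k + 1 - #((x : Finset β) ∪ x')).choose k : ℤ) := by
    ext x x'
    simp only [of_apply, hβ]
    congr 2
  rw [hcardM]
  have hmid := AntiBandMiddleLevel.gram_sub_zeta_sign_zeta_eq_binomial k hβ U hUk hup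
  -- (A)  V S Z = V
  have hVSZ : V * S * Z = V := by
    ext y x
    rw [Matrix.mul_apply]
    simp only [hVdef, hZdef, hSdef, Matrix.mul_diagonal, of_apply]
    have h1 : ∑ z : ↥U, (if ((z : Finset β) ⊆ (y : Finset β)) then (1 : ℤ) else 0) * (-1 : ℤ) ^ (k - #(z : Finset β)) *
          (if (x : Finset β) ⊆ (z : Finset β) then (1 : ℤ) else 0)
        = ∑ z ∈ U.filter (fun z => (x : Finset β) ⊆ z ∧ z ⊆ (y : Finset β)), (-1 : ℤ) ^ (k - #z) := by
      rw [Finset.sum_filter]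
      rw [← Finset.sum_coe_sort U]
      apply Finset.sum_congr rfl
      intro z _
      by_cases ha : (x : Finset β) ⊆ (z : Finset β) <;> by_cases hb : (z : Finset β) ⊆ (y : Finset β)
      · simp [ha, hb]
      · simp [ha, hb]
      · simp [ha, hb]
      · simp [ha, hb]
    rw [h1]
    by_cases hxy : (x : Finset β) ⊆ (y : Finset β)
    · rw [if_pos hxy]
      have hy := (mem_powersetCard.mp y.2).2
      exact sum_interval_neg_one_pow k U hUk hup x y x.2 hxy hy
    · rw [if_neg hxy]
      apply Finset.sum_eq_zero
      intro z hz
      rw [mem_filter] at hz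
      exact absurd (hz.2.1.trans hz.2.2) hxy
  -- (B)  Z W = 1, hence W Z = 1
  have hZW : Z * W = 1 := by
    ext z x
    rw [Matrix.mul_apply, Matrix.one_apply]
    simp only [hZdef, hWdef, of_apply]
    have h1 : ∑ w : ↥U, (if ((w : Finset β) ⊆ (z : Finset β)) then (1 : ℤ) else 0) *
          (if (x : Finset β) ⊆ (w : Finset β) then (-1 : ℤ) ^ (#(w : Finset β) + #(x : Finset β)) else 0)
        = ∑ w ∈ U.filter (fun w => (x : Finset β) ⊆ w ∧ w ⊆ (z : Finset β)), (-1 : ℤ) ^ (#w + #(x : Finset β)) := by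
      rw [Finset.sum_filter, ← Finset.sum_coe_sort U]
      apply Finset.sum_congr rfl
      intro w _
      by_cases ha : (x : Finset β) ⊆ (w : Finset β) <;> by_cases hb : (w : Finset β) ⊆ (z : Finset β)
      · simp [ha, hb]
      · simp [ha, hb]
      · simp [ha, hb]
      · simp [ha, hb]
    rw [h1]
    by_cases hxz : (x : Finset β) ⊆ (z : Finset β)
    · rw [sum_interval_neg_one_pow_full k U hUk hup x z x.2 z.2 hxz]
      by_cases h : z = x
      · subst h; simp
      · have h' : (z : Finset β) ≠ (x : Finset β) := fun e => h (Subtype.ext e)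
        rw [if_neg h', if_neg h]
    · have h : z ≠ x := by intro e; apply hxz; rw [e]
      rw [if_neg h]
      apply Finset.sum_eq_zero
      intro w hw
      rw [mem_filter] at hw
      exact absurd (hw.2.1.trans hw.2.2) hxz
  have hWZ : W * Z = 1 := mul_eq_one_comm.mp hZW
  have hSS : S * S = 1 := by
    rw [hSdef, Matrix.diagonal_mul_diagonal, ← Matrix.diagonal_one]
    congr 1; ext z
    rw [← pow_add, ← two_mul, pow_mul, neg_one_sq, one_pow]
  have hSt : Sᵀ = S := by rw [hSdef, Matrix.diagonal_transpose]
  have hVt : Zᵀ * S * Vᵀ = Vᵀ := by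
    have := congrArg Matrix.transpose hVSZ
    rw [Matrix.transpose_mul, Matrix.transpose_mul, hSt, ← Matrix.mul_assoc] at this
    exact this
  -- a null vector
  intro hdet
  obtain ⟨c₀, hc₀, hMc₀⟩ := Matrix.exists_mulVec_eq_zero_iff.mpr hdet
  rw [← hmid] at hMc₀
  set u : ↥U → ℤ := S *ᵥ (Z *ᵥ c₀) with hudef
  set F : ↥Y → ℤ := V *ᵥ u with hFdef
  have hSSv : ∀ v : ↥U → ℤ, S *ᵥ (S *ᵥ v) = v := by
    intro v; rw [Matrix.mulVec_mulVec, hSS, Matrix.one_mulVec]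
  have hWZv : ∀ v : ↥U → ℤ, W *ᵥ (Z *ᵥ v) = v := by
    intro v; rw [Matrix.mulVec_mulVec, hWZ, Matrix.one_mulVec]
  have hZWt : ∀ v : ↥U → ℤ, Wᵀ *ᵥ (Zᵀ *ᵥ v) = v := by
    intro v; rw [Matrix.mulVec_mulVec, ← Matrix.transpose_mul, hZW, Matrix.transpose_one, Matrix.one_mulVec]
  have hVtv : ∀ v : ↥Y → ℤ, Zᵀ *ᵥ (S *ᵥ (Vᵀ *ᵥ v)) = Vᵀ *ᵥ v := by
    intro v; rw [Matrix.mulVec_mulVec, Matrix.mulVec_mulVec, hVt]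
  have e1 : V *ᵥ c₀ = F := by
    rw [hFdef, hudef, Matrix.mulVec_mulVec, Matrix.mulVec_mulVec, hVSZ]
  -- 0 = Vᵀ(V c₀) − Zᵀ(S(Z c₀)) = Zᵀ (S (Vᵀ F) − u)
  have e2 : Zᵀ *ᵥ (S *ᵥ (Vᵀ *ᵥ F) - u) = 0 := by
    have h := hMc₀
    rw [Matrix.sub_mulVec, ← Matrix.mulVec_mulVec, ← Matrix.mulVec_mulVec, ← Matrix.mulVec_mulVec, e1] at h
    rw [Matrix.mulVec_sub, hVtv]
    exact h
  have e3 : S *ᵥ (Vᵀ *ᵥ F) = u := by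
    have h := congrArg (fun v => Wᵀ *ᵥ v) e2
    simp only [Matrix.mulVec_zero] at h
    rw [hZWt] at h
    exact sub_eq_zero.mp h
  have hPu : Vᵀ *ᵥ F = S *ᵥ u := by
    rw [← hSSv (Vᵀ *ᵥ F), e3]
  have hZu : Zᵀ *ᵥ u = S *ᵥ u := by
    have h := hVtv F
    rw [hPu, hSSv] at h
    exact h
  -- the quadratic form of the kernel on `u`
  have hquad : u ⬝ᵥ (Vᵀ *ᵥ (V *ᵥ u)) - u ⬝ᵥ (Zᵀ *ᵥ u) - u ⬝ᵥ (Z *ᵥ u) = - (F ⬝ᵥ F) := by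
    have h2 : u ⬝ᵥ (Vᵀ *ᵥ (V *ᵥ u)) = F ⬝ᵥ F := by
      rw [Matrix.dotProduct_mulVec, Matrix.vecMul_transpose, ← hFdef]
    have h1 : u ⬝ᵥ (Z *ᵥ u) = u ⬝ᵥ (S *ᵥ u) := by
      rw [Matrix.dotProduct_mulVec, ← Matrix.mulVec_transpose, hZu, dotProduct_comm]
    have h3 : u ⬝ᵥ (S *ᵥ u) = F ⬝ᵥ F := by
      rw [← hPu, Matrix.dotProduct_mulVec, Matrix.vecMul_transpose, ← hFdef]
    rw [h2, h1, hZu, h3]; ring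
  -- the hypothesis, evaluated at `u`
  have hentry : ∀ z z' : ↥U, (Vᵀ * V) z z' = (((2 * k + 2 - #((z : Finset β) ∪ z')).choose (k + 1) : ℕ) : ℤ) := by
    intro z z'
    rw [Matrix.mul_apply]
    simp only [hVdef, transpose_apply, of_apply]
    set w : Finset β := (z : Finset β) ∪ z' with hw
    have h1 : ∑ y : ↥Y, (if (z : Finset β) ⊆ (y : Finset β) then (1 : ℤ) else 0) * (if (z' : Finset β) ⊆ (y : Finset β) then (1 : ℤ) else 0)
        = ∑ y ∈ Y, (if w ⊆ y then (1 : ℤ) else 0) := by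
      rw [← Finset.sum_coe_sort Y]
      apply Finset.sum_congr rfl
      intro y _
      have hiff : w ⊆ y ↔ (z : Finset β) ⊆ y ∧ (z' : Finset β) ⊆ y := by rw [hw, Finset.union_subset_iff]
      by_cases ha : (z : Finset β) ⊆ (y : Finset β) <;> by_cases hb : (z' : Finset β) ⊆ (y : Finset β)
      · have h3 : w ⊆ y := hiff.2 ⟨ha, hb⟩
        simp [ha, hb, h3]
      · have h3 : ¬ w ⊆ y := fun h => hb (hiff.1 h).2
        simp [ha, hb, h3]
      · have h3 : ¬ w ⊆ y := fun h => ha (hiff.1 h).1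
        simp [ha, hb, h3]
      · have h3 : ¬ w ⊆ y := fun h => ha (hiff.1 h).1
        simp [ha, hb, h3]
    rw [h1, Finset.sum_boole]
    by_cases hwk : #w ≤ k + 1
    · rw [hYdef, AntiBandMiddleLevel.card_filter_powersetCard_superset w (k + 1) hwk, hβ,
        Nat.choose_symm_of_eq_add (show 2 * k + 2 - #w = (k + 1 - #w) + (k + 1) by omega)]
    · rw [hYdef, AntiBandMiddleLevel.filter_powersetCard_superset_eq_empty w (k + 1) (by omega), card_empty,
        Nat.choose_eq_zero_of_lt (by omega)]
  have hQu := hQ (fun z => (u z : ℚ))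
  have hcast : (∑ z : ↥U, ∑ z' : ↥U, ((u z : ℚ)) * ((u z' : ℚ)) *
        ((((2 * k + 2 - #((z : Finset β) ∪ z')).choose (k + 1) : ℕ) : ℚ)
          - (if (z : Finset β) ⊆ z' then 1 else 0) - (if (z' : Finset β) ⊆ z then 1 else 0)))
      = ((u ⬝ᵥ (Vᵀ *ᵥ (V *ᵥ u)) - u ⬝ᵥ (Zᵀ *ᵥ u) - u ⬝ᵥ (Z *ᵥ u) : ℤ) : ℚ) := by
    rw [Matrix.mulVec_mulVec]
    simp only [dotProduct, Matrix.mulVec, hentry, hZdef, transpose_apply, of_apply]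
    push_cast
    rw [← Finset.sum_sub_distrib, ← Finset.sum_sub_distrib]
    apply Finset.sum_congr rfl; intro z _
    rw [Finset.mul_sum, Finset.mul_sum, Finset.mul_sum, ← Finset.sum_sub_distrib, ← Finset.sum_sub_distrib]
    apply Finset.sum_congr rfl; intro z' _
    split_ifs <;> ring
  rw [hcast, hquad] at hQu
  have hF0 : F ⬝ᵥ F ≤ 0 := by
    have h0 : (0 : ℤ) ≤ -(F ⬝ᵥ F) := by exact_mod_cast hQu
    linarith
  have hFnn : 0 ≤ F ⬝ᵥ F := Finset.sum_nonneg (fun i _ => mul_self_nonneg _)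
  have hF : F = 0 := dotProduct_self_eq_zero.mp (le_antisymm hF0 hFnn)
  -- unwind: u = 0, Z c₀ = 0, c₀ = 0
  have hu : u = 0 := by
    rw [← hSSv u, ← hPu, hF, Matrix.mulVec_zero, Matrix.mulVec_zero]
  have hZc : Z *ᵥ c₀ = 0 := by
    rw [← hSSv (Z *ᵥ c₀), ← hudef, hu, Matrix.mulVec_zero]
  apply hc₀
  rw [← hWZv c₀, hZc, Matrix.mulVec_zero]

end Summit.CriticalPhenomena.PercolationContinuityZ3.Theorems.AntiBandDiagGap
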